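import Mathlib
import Summits.KontsevichZagierPeriods.Zeta5Search.CatalanQSumTwoAdicProof
import HarnessLib

/-!
# Catalan box family — the Beta weights `t_μ = B(μ+1, ½)` of the defining series: telescoping and exact 2-adic valuation

HONEST FRAMING: systematic search; no irrationality claim unless certified.

Cell `pub-zeta5`, family-designer seat `fam-catalan` (`families/catalan/TWOADIC.md` §7–§9).  The Catalan box linear forms are
`J(c) = Σ_{μ ≥ l} t_μ R_c(μ)` with the Beta weights `t_μ = B(μ+1, ½) = 2·4^μ (μ!)² / (2μ+1)!` and a rational function `R_c`.
Two ELEMENTARY facts about `t_μ` carry the lane's 2-adic analysis, and are recorded here as theorems (nothing in this file is a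
statement about Catalan's constant or about any 2-adic constant):

* `tB_div_eq_telescope` : `t_ν / ν = 2 t_{ν-1} − 2 t_ν` (`ν ≥ 1`), hence `tB_sum_div` : `Σ_{ν=1}^{N} t_ν/ν = 4 − 2 t_N` — the ONE
  numerical constant (`Σ t_ν/ν = 4`, in ℝ and in ℚ₂ alike, since `t_N → 0` in both) on which the formal transfer of the
  partial-fraction reduction to ℚ₂ rests (TWOADIC §8, item K5a);
* `padicValRat_two_tB` : `v₂(t_μ) = 2μ + 1 − s₂(μ)` (`s₂` = binary digit sum; Legendre), and `padicValRat_two_tB_lt_succ` :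
  `v₂(t_{μ+1}) ≥ v₂(t_μ) + 1` — the strictly increasing first factor of the ultrametric "first-term" valuation law (TWOADIC §7, F13♯).

Tools: p3 gen-2's `CatalanQSum.padicValNat_two_factorial` (Legendre in digit-sum form, `CatalanQSumTwoAdicProof.lean`).  0 sorry.
-/

open Finset

namespace Summit.KontsevichZagierPeriods.Zeta5Search.CatalanTwoAdicSeries

open Summit.KontsevichZagierPeriods.Zeta5Search.CatalanQSum (padicValNat_two_factorial)

/-- The Beta weight `t_μ = B(μ+1, ½) = 2·4^μ·(μ!)²/(2μ+1)!` of the defining series of the Catalan box forms. -/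
def tB (μ : ℕ) : ℚ := 2 * 4 ^ μ * ((μ.factorial : ℚ) ^ 2) / ((2 * μ + 1).factorial : ℚ)

/-- `t_0 = 2`. -/
theorem tB_zero : tB 0 = 2 := by simp [tB]

/-- `t_1 = 4/3`. -/
theorem tB_one : tB 1 = 4 / 3 := by norm_num [tB, Nat.factorial]

/-- The Beta weights are positive. -/
theorem tB_pos (μ : ℕ) : 0 < tB μ := by
  unfold tB
  positivity

/-- The Beta weights are non-zero. -/
theorem tB_ne_zero (μ : ℕ) : tB μ ≠ 0 := (tB_pos μ).ne'

/-- The term ratio: `t_{μ+1} = t_μ · (2μ+2)/(2μ+3)`. -/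
theorem tB_succ (μ : ℕ) : tB (μ + 1) = tB μ * (2 * μ + 2) / (2 * μ + 3) := by
  unfold tB
  have h1 : ((2 * (μ + 1) + 1).factorial : ℚ) = (2 * μ + 3) * (2 * μ + 2) * ((2 * μ + 1).factorial : ℚ) := by
    rw [show 2 * (μ + 1) + 1 = (2 * μ + 2) + 1 by ring, Nat.factorial_succ, show 2 * μ + 2 = (2 * μ + 1) + 1 by ring,
      Nat.factorial_succ]
    push_cast
    ring
  have h2 : ((μ + 1).factorial : ℚ) = (μ + 1) * (μ.factorial : ℚ) := by
    rw [Nat.factorial_succ]; push_cast; ring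
  rw [h1, h2]
  have hf : ((2 * μ + 1).factorial : ℚ) ≠ 0 := by positivity
  have h3 : (2 * (μ : ℚ) + 3) ≠ 0 := by positivity
  have h4 : (2 * (μ : ℚ) + 2) ≠ 0 := by positivity
  field_simp
  ring

/-- **Telescoping identity (K5a's constant).** `t_ν / ν = 2 t_{ν−1} − 2 t_ν` for `ν ≥ 1` (stated with `ν = μ + 1`). -/
theorem tB_div_eq_telescope (μ : ℕ) : tB (μ + 1) / (μ + 1 : ℚ) = 2 * tB μ - 2 * tB (μ + 1) := by
  rw [tB_succ]
  have h3 : (2 * (μ : ℚ) + 3) ≠ 0 := by positivity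
  have h4 : ((μ : ℚ) + 1) ≠ 0 := by positivity
  field_simp
  ring

/-- **Partial sums.** `Σ_{ν=1}^{N} t_ν/ν = 4 − 2 t_N` (so the full sum is `4` wherever `t_N → 0`: in ℝ and in ℚ₂). -/
theorem tB_sum_div (N : ℕ) : ∑ ν ∈ range N, tB (ν + 1) / (ν + 1 : ℚ) = 4 - 2 * tB N := by
  induction N with
  | zero => simp [tB_zero]; norm_num
  | succ N ih => rw [sum_range_succ, ih, tB_div_eq_telescope]; ring

/-! ### The exact 2-adic valuation of `t_μ` -/

/-- Binary digit sum is unchanged by doubling. -/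
theorem digits_two_sum_two_mul (μ : ℕ) : (Nat.digits 2 (2 * μ)).sum = (Nat.digits 2 μ).sum := by
  rcases Nat.eq_zero_or_pos μ with rfl | hμ
  · simp
  · rw [Nat.digits_def' (by norm_num) (by omega)]
    simp [Nat.mul_mod_right, Nat.mul_div_cancel_left μ two_pos]

/-- Legendre for `(2μ)!` in digit form: `v₂((2μ)!) = 2μ − s₂(μ)`. -/
theorem padicValNat_two_factorial_two_mul (μ : ℕ) :
    (padicValNat 2 (2 * μ).factorial : ℤ) = 2 * μ - ((Nat.digits 2 μ).sum : ℤ) := by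
  rw [padicValNat_two_factorial, digits_two_sum_two_mul]; push_cast; ring

/-- `v₂((2μ+1)!) = v₂((2μ)!) = 2μ − s₂(μ)` (the extra factor `2μ+1` is odd). -/
theorem padicValNat_two_factorial_two_mul_add_one (μ : ℕ) :
    (padicValNat 2 (2 * μ + 1).factorial : ℤ) = 2 * μ - ((Nat.digits 2 μ).sum : ℤ) := by
  rw [Nat.factorial_succ, padicValNat.mul (by omega) (Nat.factorial_ne_zero _),
    padicValNat.eq_zero_of_not_dvd (by omega), zero_add, padicValNat_two_factorial_two_mul]

/-- **Exact valuation (F13♯, first factor).** `v₂(t_μ) = 2μ + 1 − s₂(μ)`. -/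
theorem padicValRat_two_tB (μ : ℕ) :
    padicValRat 2 (tB μ) = 2 * (μ : ℤ) + 1 - ((Nat.digits 2 μ).sum : ℤ) := by
  unfold tB
  have hf1 : ((μ.factorial : ℚ)) ≠ 0 := by positivity
  have hf2 : (((2 * μ + 1).factorial : ℕ) : ℚ) ≠ 0 := by positivity
  have h4 : (4 : ℚ) ^ μ ≠ 0 := by positivity
  have h2 : (2 : ℚ) ≠ 0 := by norm_num
  rw [padicValRat.div (by positivity) hf2, padicValRat.mul (by positivity) (pow_ne_zero _ hf1),
    padicValRat.mul h2 h4, padicValRat.pow (4 : ℚ), padicValRat.pow (μ.factorial : ℚ)]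
  have hv2 : padicValRat 2 (2 : ℚ) = 1 := by simpa using padicValRat.self (p := 2) one_lt_two
  have hv4 : padicValRat 2 (4 : ℚ) = 2 := by
    rw [show (4 : ℚ) = 2 * 2 by norm_num, padicValRat.mul h2 h2, hv2]; norm_num
  have hvf : padicValRat 2 (μ.factorial : ℚ) = (μ : ℤ) - ((Nat.digits 2 μ).sum : ℤ) := by
    rw [padicValRat.of_nat, padicValNat_two_factorial]
  have hvf2 : padicValRat 2 (((2 * μ + 1).factorial : ℕ) : ℚ) = 2 * (μ : ℤ) - ((Nat.digits 2 μ).sum : ℤ) := by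
    rw [padicValRat.of_nat, padicValNat_two_factorial_two_mul_add_one]
  rw [hv2, hv4, hvf, hvf2]
  ring

/-- Kummer's carry count in digit form: `s₂(μ+1) = s₂(μ) + 1 − v₂(μ+1)`, from Legendre at `μ` and `μ+1`. -/
theorem digits_two_sum_succ (μ : ℕ) :
    ((Nat.digits 2 (μ + 1)).sum : ℤ) = (Nat.digits 2 μ).sum + 1 - (padicValNat 2 (μ + 1) : ℤ) := by
  have h1 := padicValNat_two_factorial (μ + 1)
  have h0 := padicValNat_two_factorial μ
  have hm : padicValNat 2 (μ + 1).factorial = padicValNat 2 (μ + 1) + padicValNat 2 μ.factorial := by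
    rw [Nat.factorial_succ, padicValNat.mul (by omega) (Nat.factorial_ne_zero _)]
  rw [hm] at h1
  push_cast [Nat.cast_add] at h1 h0 ⊢
  omega

/-- **Strict increase (F13♯).** `v₂(t_{μ+1}) ≥ v₂(t_μ) + 1`; precisely `v₂(t_{μ+1}) − v₂(t_μ) = 1 + v₂(μ+1)`. -/
theorem padicValRat_two_tB_succ_sub (μ : ℕ) :
    padicValRat 2 (tB (μ + 1)) - padicValRat 2 (tB μ) = 1 + (padicValNat 2 (μ + 1) : ℤ) := by
  rw [padicValRat_two_tB, padicValRat_two_tB, digits_two_sum_succ]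
  push_cast
  ring

/-- `v₂(t_{μ+1}) ≥ v₂(t_μ) + 1`. -/
theorem padicValRat_two_tB_lt_succ (μ : ℕ) : padicValRat 2 (tB μ) + 1 ≤ padicValRat 2 (tB (μ + 1)) := by
  have h := padicValRat_two_tB_succ_sub μ
  have h0 : (0 : ℤ) ≤ (padicValNat 2 (μ + 1) : ℤ) := by positivity
  linarith

/-- `v₂(t_μ)` is strictly monotone in `μ`. -/
theorem padicValRat_two_tB_strictMono : StrictMono fun μ => padicValRat 2 (tB μ) :=
  strictMono_nat_of_lt_succ fun μ => by
    have h := padicValRat_two_tB_lt_succ μ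
    show padicValRat 2 (tB μ) < padicValRat 2 (tB (μ + 1))
    linarith

/-- Sanity instances (kernel arithmetic): `v₂(t₀,…,t₅) = 1, 2, 4, 5, 8, 9`. -/
example : (List.range 6).map (fun μ : ℕ => 2 * (μ : ℤ) + 1 - ((Nat.digits 2 μ).sum : ℤ)) = [1, 2, 4, 5, 8, 9] := by decide

end Summit.KontsevichZagierPeriods.Zeta5Search.CatalanTwoAdicSeries
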